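import Mathlib.Analysis.SpecialFunctions.SmoothTransition
import Mathlib.Analysis.InnerProductSpace.Calculus
import Mathlib.Analysis.Calculus.FDeriv.Norm
import Mathlib.Topology.MetricSpace.ProperSpace
import HarnessLib

/-!
# Radial cut-offs for a pair of balls or annuli, with gradient bound `M / (R₂ − R₁)`

The standard cut-off of local energy estimates ("let `φ` be a cutoff for `B_{R/2} ⊂ B_R` with
`|∇φ| ≤ 4/R`", Waldron 2019, proof of Lemma 3.2; "a cutoff for `U₁ ⋐ U₂`", Lemma 3.3): on a real
inner product space, for `0 < R₁ < R₂` the radial function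
`φ(y) = smoothTransition ((R₂ − ‖y − x₀‖)/(R₂ − R₁))` is smooth, takes values in `[0, 1]`, equals
`1` on `B̄_{R₁}(x₀)`, vanishes on `{‖y − x₀‖ ≥ R₂}`, and `‖Dφ‖ ≤ M/(R₂ − R₁)` for one absolute
constant `M` (a bound for the derivative of `Real.smoothTransition`). Products give annular
cut-offs.

* `exists_radial_cutoff_gradient_le` — cut-offs for `B̄_{R₁}(x₀) ⊂ B_{R₂}(x₀)` with
  `‖Dφ‖ ≤ M/(R₂ − R₁)` (`M` bounds `|smoothTransition'|`, which vanishes off `[0,1]`; cf. the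
  same folklore bound in `Literature.Analysis.FluidPDE.exists_abs_deriv_smoothTransition_le`);
* `exists_annular_cutoff_gradient_le` — cut-offs for `B̄_{r₂} ∖ B_{r₁} ⊂ B_{ρ₂} ∖ B̄_{ρ₁}` with
  `‖Dφ‖ ≤ M(1/(r₁ − ρ₁) + 1/(ρ₂ − r₂))`.

[folklore]
-/

noncomputable section

open Set Metric Filter Function Real
open scoped Topology ContDiff

namespace Literature.Analysis.Calculus

/-! ### Radial cut-offs -/

variable {E : Type*} [NormedAddCommGroup E] [InnerProductSpace ℝ E]

/-- The radial profile `y ↦ smoothTransition ((R₂ − ‖y − x₀‖)/(R₂ − R₁))` is smooth (it is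
locally constant near the centre). [folklore] -/
theorem contDiff_smoothTransition_radial (x₀ : E) {R₁ R₂ : ℝ} (hR₁ : 0 < R₁) (h12 : R₁ < R₂) :
    ContDiff ℝ ∞ fun y : E => smoothTransition ((R₂ - ‖y - x₀‖) / (R₂ - R₁)) := by
  refine contDiff_iff_contDiffAt.2 fun y => ?_
  by_cases hy : y = x₀
  · -- near the centre the function is identically `1`
    subst hy
    have hev : (fun z : E => smoothTransition ((R₂ - ‖z - y‖) / (R₂ - R₁))) =ᶠ[𝓝 y]
        fun _ => (1 : ℝ) := by
      filter_upwards [Metric.ball_mem_nhds y hR₁] with z hz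
      refine smoothTransition.one_of_one_le ?_
      rw [le_div_iff₀ (sub_pos.mpr h12), one_mul]
      have : ‖z - y‖ < R₁ := by rwa [← dist_eq_norm]
      linarith
    exact (contDiffAt_const (c := (1 : ℝ))).congr_of_eventuallyEq hev
  · have hnorm : ContDiffAt ℝ ∞ (fun z : E => ‖z - x₀‖) y :=
      (contDiffAt_id.sub contDiffAt_const).norm ℝ (sub_ne_zero.mpr hy)
    have hlin : ContDiffAt ℝ ∞ (fun z : E => (R₂ - ‖z - x₀‖) / (R₂ - R₁)) y :=
      (contDiffAt_const.sub hnorm).div_const _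
    exact (smoothTransition.contDiffAt (n := ⊤)).comp y hlin

variable [FiniteDimensional ℝ E]

/-- **Radial cut-offs with gradient bound.** There is an absolute constant `M ≥ 0` such that
for every centre `x₀` and radii `0 < R₁ < R₂` there is a `C^∞` function `φ : E → [0, 1]` with
`φ = 1` on `closedBall x₀ R₁`, `φ = 0` on `{R₂ ≤ dist y x₀}`, compact support, and
`‖fderiv ℝ φ y‖ ≤ M / (R₂ − R₁)` everywhere. [folklore] -/
theorem exists_radial_cutoff_gradient_le :
    ∃ M : ℝ, 0 ≤ M ∧ ∀ (x₀ : E) (R₁ R₂ : ℝ), 0 < R₁ → R₁ < R₂ → ∃ φ : E → ℝ,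
      ContDiff ℝ ∞ φ ∧ (∀ y, 0 ≤ φ y) ∧ (∀ y, φ y ≤ 1) ∧
      (∀ y, dist y x₀ ≤ R₁ → φ y = 1) ∧ (∀ y, R₂ ≤ dist y x₀ → φ y = 0) ∧
      HasCompactSupport φ ∧ ∀ y, ‖fderiv ℝ φ y‖ ≤ M / (R₂ - R₁) := by
  -- `|smoothTransition'| ≤ M`: the derivative is continuous and vanishes off `[0, 1]`
  have hderiv0 : ∀ {x : ℝ}, x ∉ Icc (0 : ℝ) 1 → deriv smoothTransition x = 0 := by
    intro x hx
    rcases lt_or_gt_of_ne (fun h : x = 0 => hx ⟨h.ge, by rw [h]; exact zero_le_one⟩) with h0 | h0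
    · have hev : smoothTransition =ᶠ[𝓝 x] fun _ => (0 : ℝ) := by
        filter_upwards [(isOpen_gt' (0 : ℝ)).mem_nhds h0] with z hz
        exact smoothTransition.zero_of_nonpos (le_of_lt hz)
      rw [hev.deriv_eq]
      exact deriv_const x 0
    · have h1 : 1 < x := by
        by_contra h
        exact hx ⟨h0.le, not_lt.mp h⟩
      have hev : smoothTransition =ᶠ[𝓝 x] fun _ => (1 : ℝ) := by
        filter_upwards [(isOpen_lt' (1 : ℝ)).mem_nhds h1] with z hz
        exact smoothTransition.one_of_one_le (le_of_lt hz)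
      rw [hev.deriv_eq]
      exact deriv_const x 1
  obtain ⟨M, hM0, hM⟩ : ∃ M : ℝ, 0 ≤ M ∧ ∀ x, |deriv smoothTransition x| ≤ M := by
    have hcont : Continuous (deriv smoothTransition) :=
      (smoothTransition.contDiff (n := 1)).continuous_deriv le_rfl
    obtain ⟨M, hM⟩ := isCompact_Icc.exists_bound_of_continuousOn (s := Icc (0 : ℝ) 1)
      hcont.continuousOn
    refine ⟨max M 0, le_max_right _ _, fun x => ?_⟩
    by_cases hx : x ∈ Icc (0 : ℝ) 1
    · exact ((Real.norm_eq_abs _).symm.le.trans (hM x hx)).trans (le_max_left _ _)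
    · rw [hderiv0 hx, abs_zero]
      exact le_max_right _ _
  refine ⟨M, hM0, fun x₀ R₁ R₂ hR₁ h12 => ?_⟩
  have hd : 0 < R₂ - R₁ := sub_pos.mpr h12
  set φ : E → ℝ := fun y => smoothTransition ((R₂ - ‖y - x₀‖) / (R₂ - R₁)) with hφ
  have hsmooth : ContDiff ℝ ∞ φ := contDiff_smoothTransition_radial x₀ hR₁ h12
  have hone : ∀ y, dist y x₀ ≤ R₁ → φ y = 1 := by
    intro y hy
    refine smoothTransition.one_of_one_le ?_
    rw [le_div_iff₀ hd, one_mul, ← dist_eq_norm]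
    linarith
  have hzero : ∀ y, R₂ ≤ dist y x₀ → φ y = 0 := by
    intro y hy
    refine smoothTransition.zero_of_nonpos (div_nonpos_of_nonpos_of_nonneg ?_ hd.le)
    rw [← dist_eq_norm]
    linarith
  have hsupp : HasCompactSupport φ := by
    refine IsCompact.of_isClosed_subset (isCompact_closedBall x₀ R₂) (isClosed_tsupport φ) ?_
    refine closure_minimal (fun y hy => ?_) isClosed_closedBall
    rw [mem_closedBall]
    by_contra h
    exact hy (hzero y (le_of_lt (not_le.mp h)))
  -- the gradient bound
  have hlip : LipschitzWith 1 fun z : E => ‖z - x₀‖ := LipschitzWith.of_dist_le_mul fun a c => by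
    rw [NNReal.coe_one, one_mul, Real.dist_eq, dist_eq_norm]
    calc |‖a - x₀‖ - ‖c - x₀‖| ≤ ‖(a - x₀) - (c - x₀)‖ := abs_norm_sub_norm_le _ _
      _ = ‖a - c‖ := by rw [sub_sub_sub_cancel_right]
  have hgrad : ∀ y, ‖fderiv ℝ φ y‖ ≤ M / (R₂ - R₁) := by
    intro y
    by_cases hy : y = x₀
    · -- locally constant near the centre
      subst hy
      have hev : φ =ᶠ[𝓝 y] fun _ => (1 : ℝ) := by
        filter_upwards [Metric.ball_mem_nhds y hR₁] with z hz
        exact hone z (le_of_lt (mem_ball.mp hz))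
      rw [hev.fderiv_eq, fderiv_const_apply, norm_zero]
      positivity
    · -- chain rule away from the centre
      have hn : DifferentiableAt ℝ (fun z : E => ‖z - x₀‖) y :=
        ((contDiffAt_id.sub contDiffAt_const : ContDiffAt ℝ 1 (fun z : E => z - x₀) y).norm ℝ
          (sub_ne_zero.mpr hy)).differentiableAt one_ne_zero
      set Ln : E →L[ℝ] ℝ := fderiv ℝ (fun z : E => ‖z - x₀‖) y with hLn'
      have hLn : ‖Ln‖ ≤ 1 := by
        have h := norm_fderiv_le_of_lipschitz ℝ (f := fun z : E => ‖z - x₀‖) (x₀ := y) hlip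
        simpa using h
      have hℓ : HasFDerivAt (fun z : E => (R₂ - ‖z - x₀‖) / (R₂ - R₁))
          ((R₂ - R₁)⁻¹ • -Ln) y := by
        have h := (hn.hasFDerivAt.const_sub R₂).mul_const (R₂ - R₁)⁻¹
        simpa only [div_eq_mul_inv] using h
      have hst : HasDerivAt smoothTransition
          (deriv smoothTransition ((R₂ - ‖y - x₀‖) / (R₂ - R₁)))
          ((R₂ - ‖y - x₀‖) / (R₂ - R₁)) :=
        ((smoothTransition.contDiffAt (n := 1)).differentiableAt (by simp)).hasDerivAt
      have hφ' : HasFDerivAt φ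
          (deriv smoothTransition ((R₂ - ‖y - x₀‖) / (R₂ - R₁)) • ((R₂ - R₁)⁻¹ • -Ln)) y := by
        have h := hst.comp_hasFDerivAt y hℓ
        rw [hφ]
        exact h
      rw [hφ'.fderiv, norm_smul, norm_smul, norm_neg, Real.norm_eq_abs, Real.norm_eq_abs,
        abs_of_pos (inv_pos.mpr hd)]
      calc |deriv smoothTransition ((R₂ - ‖y - x₀‖) / (R₂ - R₁))| * ((R₂ - R₁)⁻¹ * ‖Ln‖)
          ≤ M * ((R₂ - R₁)⁻¹ * 1) := by
            gcongr
            exact hM _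
        _ = M / (R₂ - R₁) := by rw [mul_one, div_eq_mul_inv]
  exact ⟨φ, hsmooth, fun y => smoothTransition.nonneg _, fun y => smoothTransition.le_one _, hone,
    hzero, hsupp, hgrad⟩

/-- **Annular cut-offs with gradient bound.** With the same absolute constant `M`, for every
centre `x₀` and radii `0 < ρ₁ < r₁ ≤ r₂ < ρ₂` there is a `C^∞` function `φ : E → [0, 1]` with
`φ = 1` on the closed annulus `{r₁ ≤ dist y x₀ ≤ r₂}`, `φ = 0` on `closedBall x₀ ρ₁` and on
`{ρ₂ ≤ dist y x₀}`, compact support, and `‖fderiv ℝ φ y‖ ≤ M/(r₁ − ρ₁) + M/(ρ₂ − r₂)` (product of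
an outer radial cut-off and one minus an inner one). [folklore] -/
theorem exists_annular_cutoff_gradient_le :
    ∃ M : ℝ, 0 ≤ M ∧ ∀ (x₀ : E) (ρ₁ r₁ r₂ ρ₂ : ℝ), 0 < ρ₁ → ρ₁ < r₁ → r₁ ≤ r₂ → r₂ < ρ₂ →
      ∃ φ : E → ℝ, ContDiff ℝ ∞ φ ∧ (∀ y, 0 ≤ φ y) ∧ (∀ y, φ y ≤ 1) ∧
      (∀ y, r₁ ≤ dist y x₀ → dist y x₀ ≤ r₂ → φ y = 1) ∧
      (∀ y, dist y x₀ ≤ ρ₁ → φ y = 0) ∧ (∀ y, ρ₂ ≤ dist y x₀ → φ y = 0) ∧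
      HasCompactSupport φ ∧ ∀ y, ‖fderiv ℝ φ y‖ ≤ M / (r₁ - ρ₁) + M / (ρ₂ - r₂) := by
  obtain ⟨M, hM0, hrad⟩ := exists_radial_cutoff_gradient_le (E := E)
  refine ⟨M, hM0, fun x₀ ρ₁ r₁ r₂ ρ₂ hρ₁ h1 h12 h2 => ?_⟩
  obtain ⟨ψ, hψs, hψ0, hψ1, hψone, hψzero, hψc, hψgrad⟩ := hrad x₀ r₂ ρ₂ (by linarith) h2
  obtain ⟨χ, hχs, hχ0, hχ1, hχone, hχzero, -, hχgrad⟩ := hrad x₀ ρ₁ r₁ hρ₁ h1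
  refine ⟨fun y => ψ y * (1 - χ y), hψs.mul (contDiff_const.sub hχs),
    fun y => mul_nonneg (hψ0 y) (sub_nonneg.mpr (hχ1 y)),
    fun y => mul_le_one₀ (hψ1 y) (sub_nonneg.mpr (hχ1 y)) (sub_le_self _ (hχ0 y)),
    fun y hy1 hy2 => ?_, fun y hy => ?_, fun y hy => ?_, hψc.mul_right, fun y => ?_⟩
  · beta_reduce
    rw [hψone y hy2, hχzero y hy1, sub_zero, mul_one]
  · beta_reduce
    rw [hχone y hy, sub_self, mul_zero]
  · beta_reduce
    rw [hψzero y hy, zero_mul]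
  · have hψd : DifferentiableAt ℝ ψ y := (hψs.differentiable (by simp)) y
    have hχd' : DifferentiableAt ℝ χ y := (hχs.differentiable (by simp)) y
    have hχd : DifferentiableAt ℝ (fun z => 1 - χ z) y := hχd'.const_sub 1
    rw [fderiv_fun_mul hψd hχd, fderiv_const_sub]
    calc ‖ψ y • -fderiv ℝ χ y + (1 - χ y) • fderiv ℝ ψ y‖
        ≤ ‖ψ y • -fderiv ℝ χ y‖ + ‖(1 - χ y) • fderiv ℝ ψ y‖ := norm_add_le _ _
      _ = |ψ y| * ‖fderiv ℝ χ y‖ + |1 - χ y| * ‖fderiv ℝ ψ y‖ := by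
          rw [norm_smul, norm_smul, norm_neg, Real.norm_eq_abs, Real.norm_eq_abs]
      _ ≤ 1 * (M / (r₁ - ρ₁)) + 1 * (M / (ρ₂ - r₂)) := by
          gcongr
          · exact abs_le.mpr ⟨by linarith [hψ0 y], hψ1 y⟩
          · exact hχgrad y
          · exact abs_le.mpr ⟨by linarith [hχ0 y, hχ1 y], by linarith [hχ0 y]⟩
          · exact hψgrad y
      _ = M / (r₁ - ρ₁) + M / (ρ₂ - r₂) := by ring

end Literature.Analysis.Calculus
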